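import Mathlib.Data.ZMod.ValMinAbs
import Mathlib.Data.Nat.Factorial.BigOperators
import Mathlib.Data.Fintype.Perm
import Mathlib.Data.Set.Card
import Mathlib.Order.Hom.Basic
import Literature.IUT.HodgeTheaters.BaseHodgeTheaters
import HarnessLib

/-!
# Processions and the étale-picture of base-ΘNF-Hodge theaters ([IUTchI] Definition 4.10, Proposition 4.11,
# Corollary 4.12; the label counts of Proposition 4.9 (ii) and Remark 4.9.2 (iii)) — abc-iut cell, layer L5

Mochizuki, *Inter-universal Teichmüller theory I*, §4 (kurims May-2020 manuscript), pp. 116–122.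

* Definition 4.10 p. 119–120: an `n`-*procession* `P₁ ↪ P₂ ↪ … ↪ Pₙ` of a category `C` (`P_j` a `j`-capsule, each
  arrow "the collection of all capsule-full poly-morphisms", hence no datum) and morphisms of processions
  (an order-preserving injection `{1,…,n} ↪ {1,…,m}` with capsule-full poly-morphisms `P_j ↪ Q_{ι(j)}`, i.e.
  injections of index sets) — `Procession`, `Procession.Hom`, for an arbitrary category.
* The positive-integer labels: "we use the notation for positive integers to denote the images of these
  positive integers in `F_l^⋇`" (Prop. 4.11 (i)): `FlStar.absVal` (the representative in `{1,…,l^⋇}`, PROVED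
  injective with the right range), `SStar j = S^⋇_j = {1,…,j} ⊆ F_l^⋇`, `S^⋇_{l^⋇} = F_l^⋇` (`sStar_lStar`) and
  `|S^⋇_j| = j` (`ncard_sStar`), all PROVED.
* Proposition 4.11 (i)–(ii) p. 120–121: the `l^⋇`-procession `Prc(†𝒟_J)` of a `𝒟`-Θ-bridge, by the sub-capsules
  on `S^⋇_1 ⊆ … ⊆ S^⋇_{l^⋇}` relative to `†χ` (`DThetaBridge.prc`), functorial in (the unique) isomorphisms of
  `𝒟`-Θ-bridges (`DThetaBridge.Hom.prc`), its mono-analyticisation `Prc(†𝒟^⊢_J)` (`DThetaBridge.prcMono`), and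
  the indeterminacy count: the index set of the `n`-capsule corresponds to exactly the `n` labels of `S^⋇_n`
  (`DThetaBridge.χ_image_prcIdx`), so that "the indeterminacy consisting of `(l^⋇)^{l^⋇}` possibilities [Prop.
  4.9 (ii): `card_labelings`] is reduced to an indeterminacy consisting of a total of `l^⋇!` possibilities"
  (`prod_procession_possibilities`, `factorial_lStar_lt_pow`, `card_perm_labels`) — PROVED; Remark 4.9.2 (iii)
  (`indepIndeterminacy_eq`) PROVED.
* Corollary 4.12 (i)–(iii) p. 121–122: the functor `†ℋ𝒯^{𝒟-ΘNF} ↦ †𝒟_> ↦ †𝒟_>^⊢` (`DThetaNFHodgeTheater.monoCod`),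
  the `𝒟`-ΘNF-link = "the full poly-isomorphism `†𝒟_>^⊢ ⥲ ‡𝒟_>^⊢`" (`DThetaNFLink`, nonempty); (ii) an infinite
  chain of `𝒟`-ΘNF-linked Hodge theaters (`DThetaNFChain`) yields a chain of full poly-isomorphisms whose
  output is "a constant invariant — i.e., a mono-analytic core" (`DThetaNFChain.core_spec`); (iii) the
  étale-picture — spokes around the core — "admits arbitrary permutation symmetries among the spokes"
  (`DThetaNFChain.etalePicture_perm`). These are, as print says, "immediate consequence[s] of our discussion";
  their non-trivial content lives in §3 (Cor. 3.8, 3.9, Rem. 3.8.1, 3.9.1: Frobenius-picture vs étale-picture),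
  layer L5-t2.

Record-only; [claim: Mochizuki2012, status: disputed]; nothing here takes a side.
-/

namespace Literature.IUT.HodgeTheaters

open CategoryTheory

open scoped Nat

universe u

/-! ### Definition 4.10: processions in a category -/

/-- **Definition 4.10** ([IUTchI] p. 119–120): an `n`-*procession* of `C` is "a diagram `P₁ ↪ P₂ ↪ … ↪ Pₙ` where
each `P_j` [for `j = 1, …, n`] is a `j`-capsule of objects of `C`; each arrow `P_j ↪ P_{j+1}` denotes the
collection of all capsule-full poly-morphisms from `P_j` to `P_{j+1}`" — so the data are the capsules: for each
`j < n` (0-indexed) a finite index set with `j + 1` elements and objects of `C` indexed by it (Fig. 4.6: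
`/⋆ ↪ /⋆/⋆ ↪ /⋆/⋆/⋆ ↪ … ↪ (/⋆ … /⋆)`). [claim: Mochizuki2012, status: disputed] -/
structure Procession (C : Type u) (n : ℕ) where
  /-- the index set of the `(j+1)`-capsule `P_{j+1}` -/
  idx : Fin n → Type
  /-- the index sets are finite -/
  [finite_idx : ∀ j, Finite (idx j)]
  /-- `P_{j+1}` is a `(j+1)`-capsule -/
  card_idx : ∀ j : Fin n, Nat.card (idx j) = (j : ℕ) + 1
  /-- the constituents of the capsules -/
  obj : ∀ j, idx j → C

attribute [instance] Procession.finite_idx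

/-- **Definition 4.10, morphisms** ([IUTchI] p. 120): a morphism from an `n`-procession to an `m`-procession
"consists of an order-preserving injection `ι : {1,…,n} ↪ {1,…,m}` [so `n ≤ m`], together with a capsule-full
poly-morphism `P_j ↪ Q_{ι(j)}` for each `j = 1, …, n`" (a capsule-full poly-morphism being determined by an
injection of index sets, §0 p. 34). [claim: Mochizuki2012, status: disputed] -/
structure Procession.Hom {C : Type u} {n m : ℕ} (P : Procession C n) (Q : Procession C m) where
  /-- the order-preserving injection of `{1,…,n}` into `{1,…,m}` -/
  ι : Fin n ↪o Fin m
  /-- the injections of index sets underlying the capsule-full poly-morphisms `P_j ↪ Q_{ι(j)}` -/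
  emb : ∀ j, P.idx j ↪ Q.idx (ι j)

/-- Def. 4.10: "[so `n ≤ m`]". [claim: Mochizuki2012, status: disputed] -/
theorem Procession.Hom.le {C : Type u} {n m : ℕ} {P : Procession C n} {Q : Procession C m}
    (f : Procession.Hom P Q) : n ≤ m := by
  simpa using Fintype.card_le_of_embedding f.ι.toEmbedding

/-- The identity morphism of a procession. [claim: Mochizuki2012, status: disputed] -/
def Procession.Hom.id {C : Type u} {n : ℕ} (P : Procession C n) : Procession.Hom P P where
  ι := OrderEmbedding.id _
  emb _ := Function.Embedding.refl _

/-- Pushing a procession forward along a map on objects (used for mono-analyticisation, Prop. 4.11 (ii)).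
[claim: Mochizuki2012, status: disputed] -/
def Procession.map {C : Type u} {C' : Type u} {n : ℕ} (F : C → C') (P : Procession C n) : Procession C' n where
  idx := P.idx
  card_idx := P.card_idx
  obj j i := F (P.obj j i)

/-! ### The positive-integer labels `1, 2, …, l^⋇ ∈ F_l^⋇` and the subsets `S^⋇_j` (Prop. 4.11 (i)) -/

section PosLabels

variable (l : ℕ)

/-- The representative in `{0, 1, …, ⌊l/2⌋}` of a label class `∈ |F_l| = F_l/{±1}` (absolute value of the
representative of smallest absolute value). [claim: Mochizuki2012, status: disputed] -/
def FlAbs.absVal : FlAbs l → ℕ :=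
  Quotient.lift (fun x : ZMod l => x.valMinAbs.natAbs) fun x y h => by
    rcases plusMinusSetoid_rel_iff.1 h with rfl | rfl
    · rfl
    · exact ZMod.natAbs_valMinAbs_neg _

/-- Formula on representatives. [claim: Mochizuki2012, status: disputed] -/
@[simp] theorem FlAbs.absVal_mk (x : ZMod l) : FlAbs.absVal l (FlAbs.mk l x) = x.valMinAbs.natAbs := rfl

/-- `|F_l| → ℕ` is injective (`x ↦ |x|` identifies exactly `±x`). [claim: Mochizuki2012, status: disputed] -/
theorem FlAbs.absVal_injective : Function.Injective (FlAbs.absVal l) := by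
  intro a b h
  obtain ⟨x, rfl⟩ := FlAbs.mk_surjective l a
  obtain ⟨y, rfl⟩ := FlAbs.mk_surjective l b
  rw [FlAbs.absVal_mk, FlAbs.absVal_mk, ZMod.natAbs_valMinAbs_eq_natAbs_valMinAbs] at h
  exact FlAbs.mk_eq_mk_iff.2 h

/-- Prop. 4.11 (i): "we use the notation for positive integers to denote the images of these positive integers
in `F_l^⋇`" — conversely, the positive integer `∈ {1, …, l^⋇}` representing a label `∈ F_l^⋇`.
[claim: Mochizuki2012, status: disputed] -/
def FlStar.absVal (x : FlStar l) : ℕ := FlAbs.absVal l (FlStar.toFlAbs l x)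

/-- `F_l^⋇ → ℕ` is injective. [claim: Mochizuki2012, status: disputed] -/
theorem FlStar.absVal_injective : Function.Injective (FlStar.absVal l) :=
  (FlAbs.absVal_injective l).comp (FlStar.toFlAbs_injective l)

/-- The representative of a label lies in `{1, …, l^⋇}`. [claim: Mochizuki2012, status: disputed] -/
theorem FlStar.absVal_mem_Icc [Fact l.Prime] (hl : l ≠ 2) (x : FlStar l) : FlStar.absVal l x ∈ Set.Icc 1 (lStar l) := by
  induction x using QuotientGroup.induction_on with
  | H u =>
    change ((u : ZMod l).valMinAbs.natAbs) ∈ Set.Icc 1 (lStar l)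
    refine ⟨Nat.one_le_iff_ne_zero.2 fun h => u.ne_zero ((ZMod.valMinAbs_eq_zero _).1
      (Int.natAbs_eq_zero.1 h)), ?_⟩
    have h2 := ZMod.natAbs_valMinAbs_le (u : ZMod l)
    obtain ⟨k, hk⟩ := (Fact.out : l.Prime).odd_of_ne_two hl
    unfold lStar; omega

/-- Every positive integer `n ≤ l^⋇` is the representative of a label (namely of the image of `n`).
[claim: Mochizuki2012, status: disputed] -/
theorem FlStar.exists_absVal_eq [Fact l.Prime] {n : ℕ} (hn1 : 1 ≤ n) (hn : n ≤ lStar l) :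
    ∃ x : FlStar l, FlStar.absVal l x = n := by
  have hnl : n < l := by unfold lStar at hn; have := (Fact.out : l.Prime).two_le; omega
  have hcop : n.Coprime l := Nat.Coprime.symm ((Nat.Prime.coprime_iff_not_dvd Fact.out).2
    fun h => absurd (Nat.le_of_dvd (by omega) h) (by omega))
  refine ⟨FlStar.mk l (ZMod.unitOfCoprime n hcop), ?_⟩
  change ((ZMod.unitOfCoprime n hcop : (ZMod l)ˣ) : ZMod l).valMinAbs.natAbs = n
  rw [ZMod.coe_unitOfCoprime, ZMod.valMinAbs_natCast_of_le_half, Int.natAbs_natCast]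
  unfold lStar at hn; omega

/-- **Prop. 4.11 (i)**: `S^⋇_j := {1, 2, …, j} ⊆ F_l^⋇` (images of the positive integers `≤ j`).
[claim: Mochizuki2012, status: disputed] -/
def SStar (j : ℕ) : Set (FlStar l) := {x | FlStar.absVal l x ≤ j}

/-- `S^⋇_1 ⊆ … ⊆ S^⋇_j ⊆ …` [claim: Mochizuki2012, status: disputed] -/
theorem sStar_mono {j j' : ℕ} (h : j ≤ j') : SStar l j ⊆ SStar l j' := fun _ hx => le_trans hx h

/-- Prop. 4.11 (i): "`S^⋇_{l^⋇} := F_l^⋇`". [claim: Mochizuki2012, status: disputed] -/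
theorem sStar_lStar [Fact l.Prime] (hl : l ≠ 2) : SStar l (lStar l) = Set.univ :=
  Set.eq_univ_of_forall fun x => (FlStar.absVal_mem_Icc l hl x).2

/-- `S^⋇_j` has exactly `j` elements for `j ≤ l^⋇`. [claim: Mochizuki2012, status: disputed] -/
theorem ncard_sStar [Fact l.Prime] (hl : l ≠ 2) {j : ℕ} (hj : j ≤ lStar l) : (SStar l j).ncard = j := by
  have himg : (FlStar.absVal l) '' SStar l j = Set.Icc 1 j := by
    ext n
    constructor
    · rintro ⟨x, hx, rfl⟩
      exact ⟨(FlStar.absVal_mem_Icc l hl x).1, hx⟩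
    · rintro ⟨h1, h2⟩
      obtain ⟨x, hx⟩ := FlStar.exists_absVal_eq l h1 (le_trans h2 hj)
      exact ⟨x, by rw [SStar, Set.mem_setOf_eq, hx]; exact h2, hx⟩
  rw [← Set.ncard_image_of_injective _ (FlStar.absVal_injective l), himg, Set.ncard_eq_toFinset_card',
    Set.toFinset_Icc, Nat.card_Icc]
  omega

end PosLabels

/-! ### Label-indeterminacy counts (Prop. 4.9 (ii), Prop. 4.11 (i), Rem. 4.9.2 (iii)) -/

section Counts

variable (l : ℕ)

/-- **Prop. 4.9 (ii)** ([IUTchI] p. 116): forgetting the bijection `J ≃ F_l^⋇`, each of the `l^⋇` indices has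
`l^⋇` possible labels, `(l^⋇)^(l^⋇)` assignments in all: the number of maps from an `l^⋇`-element index set to
`F_l^⋇`. [claim: Mochizuki2012, status: disputed] -/
theorem card_labelings [Fact l.Prime] (hl : l ≠ 2) (J : Type*) [Finite J]
    (hJ : Nat.card J = lStar l) : Nat.card (J → FlStar l) = lStar l ^ lStar l := by
  rw [Nat.card_fun, hJ, card_flStar l hl]

/-- **Prop. 4.11 (i), the count** ([IUTchI] p. 120): in an `l^⋇`-procession the index of the `n`-capsule has
"precisely `n` possibilities", and "by taking the product, over elements of `F_l^⋇`, of cardinalities of sets of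
possibilities, … a total of `l^⋇ !` possibilities". [claim: Mochizuki2012, status: disputed] -/
theorem prod_procession_possibilities (n : ℕ) : ∏ i ∈ Finset.range n, (i + 1) = n ! :=
  Finset.prod_range_add_one_eq_factorial n

/-- Auxiliary: `n! < n^n` for `n ≥ 2`. [claim: Mochizuki2012, status: disputed] -/
theorem factorial_lt_pow_self {n : ℕ} (hn : 2 ≤ n) : n ! < n ^ n := by
  induction n, hn using Nat.le_induction with
  | base => decide
  | succ n hn ih =>
    rw [Nat.factorial_succ, pow_succ']
    refine Nat.mul_lt_mul_of_le_of_lt le_rfl (lt_of_lt_of_le ih ?_) (Nat.succ_pos n)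
    exact Nat.pow_le_pow_left (Nat.le_succ n) n

/-- … which is indeed a REDUCTION of the indeterminacy of Prop. 4.9 (ii): `l^⋇ ! < (l^⋇)^(l^⋇)` under the standing
assumption `l ≥ 5` ([IUTchI] Prop. 4.11 (i) p. 120: "the indeterminacy consisting of `(l^⋇)^(l^⋇)` possibilities
… is reduced to … `l^⋇ !` possibilities"). [claim: Mochizuki2012, status: disputed] -/
theorem factorial_lStar_lt_pow (hl : 5 ≤ l) : (lStar l)! < lStar l ^ lStar l :=
  factorial_lt_pow_self (two_le_lStar hl)

/-- The symmetric group on `l^⋇` letters, `𝔖_{l^⋇}` of Prop. 4.9 (ii), has `l^⋇ !` elements — the residual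
indeterminacy of Prop. 4.11 (i) is exactly one `𝔖_{l^⋇}`-worth. [claim: Mochizuki2012, status: disputed] -/
theorem card_perm_labels [Fact l.Prime] (hl : l ≠ 2) :
    Nat.card (Equiv.Perm (FlStar l)) = (lStar l)! := by
  classical
  haveI := Fintype.ofFinite (FlStar l)
  rw [Nat.card_eq_fintype_card, Fintype.card_perm, ← Nat.card_eq_fintype_card, card_flStar l hl]

/-- **Remark 4.9.2 (iii)** ([IUTchI] p. 118): "since the natural action of `F_l^⋇` on `F_l^⋇` is transitive, one
obtains the same set of all possibilities for each association, regardless of whether one considers independent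
`F_l^⋇`-indeterminacies at each index of `J` or independent `𝔖_{l^⋇}`-indeterminacies at each index of `J`":
starting from a labelling `χ : J → F_l^⋇`, modifying each value independently by a group translation, resp. by a
permutation, reaches the same set of assignments. [claim: Mochizuki2012, status: disputed] -/
theorem indepIndeterminacy_eq {J : Type*} (χ : J → FlStar l) :
    {f : J → FlStar l | ∃ g : J → FlStar l, ∀ j, f j = g j * χ j} =
      {f : J → FlStar l | ∃ σ : J → Equiv.Perm (FlStar l), ∀ j, f j = σ j (χ j)} := by
  ext f
  simp only [Set.mem_setOf_eq]
  constructor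
  · rintro ⟨g, hg⟩
    exact ⟨fun j => Equiv.mulLeft (g j), fun j => by simp [hg j]⟩
  · rintro ⟨σ, -⟩
    exact ⟨fun j => f j * (χ j)⁻¹, fun j => by simp⟩

/-- … namely EVERY assignment `J → F_l^⋇` ("correspondences … which fail to be bijective" included, Rem. 4.9.2 (i)).
[claim: Mochizuki2012, status: disputed] -/
theorem indepIndeterminacy_eq_univ {J : Type*} (χ : J → FlStar l) :
    {f : J → FlStar l | ∃ g : J → FlStar l, ∀ j, f j = g j * χ j} = Set.univ :=
  Set.eq_univ_of_forall fun f => ⟨fun j => f j * (χ j)⁻¹, fun j => by simp⟩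

end Counts

/-! ### Proposition 4.11: processions of base-prime-strips -/

namespace BaseThetaDatum

variable {𝔡 : BaseThetaDatum.{u}}

/-- Prop. 4.11 (i): the index set of the `(n+1)`-capsule of `Prc(†𝒟_J)` — the indices with label in `S^⋇_{n+1}`.
[claim: Mochizuki2012, status: disputed] -/
def DThetaBridge.prcIdx (B : 𝔡.DThetaBridge) (n : Fin (lStar 𝔡.l)) : Type :=
  {i : B.J // B.χ i ∈ SStar 𝔡.l ((n : ℕ) + 1)}

/-- The `(n+1)`-capsule of `Prc(†𝒟_J)` has `n+1` constituents. [claim: Mochizuki2012, status: disputed] -/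
theorem DThetaBridge.card_prcIdx (B : 𝔡.DThetaBridge) (n : Fin (lStar 𝔡.l)) :
    Nat.card (B.prcIdx n) = (n : ℕ) + 1 := by
  rw [DThetaBridge.prcIdx, Nat.card_congr (B.χ.subtypeEquiv fun _ => Iff.rfl), Nat.card_coe_set_eq]
  exact ncard_sStar 𝔡.l 𝔡.l_ne_two (by omega)

/-- The capsules of `Prc(†𝒟_J)` have finite index sets. [claim: Mochizuki2012, status: disputed] -/
instance DThetaBridge.finite_prcIdx (B : 𝔡.DThetaBridge) (n : Fin (lStar 𝔡.l)) : Finite (B.prcIdx n) :=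
  Finite.of_equiv _ (B.χ.subtypeEquiv fun _ => Iff.rfl).symm

/-- **Proposition 4.11 (i)** ([IUTchI] p. 120): `Prc(†𝒟_J)`, "the `l^⋇`-procession of `𝒟`-prime-strips determined
by considering the [sub]capsules of `†𝒟_J` corresponding to the subsets `S^⋇_1 ⊆ … ⊆ S^⋇_j := {1, 2, …, j} ⊆ … ⊆
S^⋇_{l^⋇} := F_l^⋇`, relative to the bijection `†χ : J ⥲ F_l^⋇` of Proposition 4.7 (i)".
[claim: Mochizuki2012, status: disputed] -/
def DThetaBridge.prc (B : 𝔡.DThetaBridge) : Procession 𝔡.DPrimeStrip (lStar 𝔡.l) where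
  idx := B.prcIdx
  card_idx := B.card_prcIdx
  obj _ i := B.capsule i.1

/-- Prop. 4.11 (i): "the assignment `†φ^Θ_⋆ ↦ Prc(†𝒟_J)` determines a natural functor" — the (unique, Prop. 4.8
(ii)) isomorphism of `𝒟`-Θ-bridges induces a morphism of processions (it preserves labels).
[claim: Mochizuki2012, status: disputed] -/
noncomputable def DThetaBridge.Hom.prc {B B' : 𝔡.DThetaBridge} (f : DThetaBridge.Hom 𝔡 B B') :
    Procession.Hom B.prc B'.prc where
  ι := OrderEmbedding.id _
  emb n := ⟨fun i => ⟨f.ι i.1, by rw [f.χ_comp]; exact i.2⟩, fun i i' h => by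
    apply Subtype.ext; apply f.ι.injective; exact congrArg (fun x => x.1) h⟩

/-- **Proposition 4.11 (i), the indeterminacy property**: the index set of the `(n+1)`-capsule of `Prc(†𝒟_J)`
corresponds under `†χ` to EXACTLY the `n+1` labels `S^⋇_{n+1} = {1, …, n+1}` — "there are precisely `n` possibilities
for the element `∈ F_l^⋇` to which a given index of the index set of the `n`-capsule … corresponds".
[claim: Mochizuki2012, status: disputed] -/
theorem DThetaBridge.χ_image_prcIdx (B : 𝔡.DThetaBridge) (n : Fin (lStar 𝔡.l)) :
    B.χ '' {i : B.J | B.χ i ∈ SStar 𝔡.l ((n : ℕ) + 1)} = SStar 𝔡.l ((n : ℕ) + 1) ∧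
      (SStar 𝔡.l ((n : ℕ) + 1)).ncard = (n : ℕ) + 1 := by
  refine ⟨?_, ncard_sStar 𝔡.l 𝔡.l_ne_two (by omega)⟩
  ext x
  constructor
  · rintro ⟨i, hi, rfl⟩; exact hi
  · intro hx; exact ⟨B.χ.symm x, by simpa using hx, by simp⟩

/-- **Proposition 4.11 (ii)** ([IUTchI] p. 120–121): `Prc(†𝒟^⊢_J)`, the `l^⋇`-procession of `𝒟^⊢`-prime-strips
obtained "by composing the functor of (i) with the mono-analyticization operation", with "the same indeterminacy
properties with respect to labels" (same index sets). [claim: Mochizuki2012, status: disputed] -/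
def DThetaBridge.prcMono (B : 𝔡.DThetaBridge) : Procession 𝔡.DMonoPrimeStrip (lStar 𝔡.l) :=
  B.prc.map DPrimeStrip.mono

/-! ### Corollary 4.12: étale-pictures of base-ΘNF-Hodge theaters -/

/-- **Corollary 4.12 (i)**, the functor `†ℋ𝒯^{𝒟-ΘNF} ↦ †𝒟_> ↦ †𝒟_>^⊢`: "the mono-analyticization of the `𝒟`-prime-strip
`†𝒟_>` that appears as the codomain of the underlying `𝒟`-Θ-bridge". [claim: Mochizuki2012, status: disputed] -/
def DThetaNFHodgeTheater.monoCod (H : 𝔡.DThetaNFHodgeTheater) : 𝔡.DMonoPrimeStrip := H.cod.mono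

variable (𝔡) in
/-- **Corollary 4.12 (i)** ([IUTchI] p. 121): the *base-ΘNF-link*, or *`𝒟`-ΘNF-link*, `†ℋ𝒯^{𝒟-ΘNF} ⟶^𝒟 ‡ℋ𝒯^{𝒟-ΘNF}`
is "the full poly-isomorphism `†𝒟_>^⊢ ⥲ ‡𝒟_>^⊢`" — the set of ALL isomorphisms of `𝒟^⊢`-prime-strips.
[claim: Mochizuki2012, status: disputed] -/
def DThetaNFLink (H H' : 𝔡.DThetaNFHodgeTheater) : PolyIso H.monoCod H'.monoCod := PolyIso.full _ _

/-- The `𝒟`-ΘNF-link between ANY two `𝒟`-ΘNF-Hodge theaters is nonempty (all `𝒟^⊢`-prime-strips are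
isomorphic). [claim: Mochizuki2012, status: disputed] -/
theorem dThetaNFLink_nonempty (H H' : 𝔡.DThetaNFHodgeTheater) : (DThetaNFLink 𝔡 H H').Nonempty :=
  let ⟨e⟩ := DMonoPrimeStrip.nonempty_iso H.monoCod H'.monoCod; ⟨e, Set.mem_univ _⟩

variable (𝔡) in
/-- **Corollary 4.12 (ii)** ([IUTchI] p. 121): "an infinite chain
`… ⟶^𝒟 ⁽ⁿ⁻¹⁾ℋ𝒯^{𝒟-ΘNF} ⟶^𝒟 ⁿℋ𝒯^{𝒟-ΘNF} ⟶^𝒟 ⁽ⁿ⁺¹⁾ℋ𝒟^{𝒟-ΘNF} ⟶^𝒟 …` [where `n ∈ ℤ`] of `𝒟`-ΘNF-linked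
`𝒟`-ΘNF-Hodge theaters" — the links being the (dataless) full poly-isomorphisms, the chain is the `ℤ`-indexed
family. [claim: Mochizuki2012, status: disputed] -/
structure DThetaNFChain where
  /-- the `n`-th Hodge theater `ⁿℋ𝒯^{𝒟-ΘNF}` -/
  HT : ℤ → 𝔡.DThetaNFHodgeTheater

/-- Cor. 4.12 (ii): "a resulting chain of full poly-isomorphisms `… ⥲ ⁿ𝒟_>^⊢ ⥲ ⁽ⁿ⁺¹⁾𝒟_>^⊢ ⥲ …`".
[claim: Mochizuki2012, status: disputed] -/
def DThetaNFChain.link (C : DThetaNFChain 𝔡) (n : ℤ) : PolyIso (C.HT n).monoCod (C.HT (n + 1)).monoCod :=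
  DThetaNFLink 𝔡 (C.HT n) (C.HT (n + 1))

/-- **Corollary 4.12 (ii)**, the mono-analytic core: "the output data of the functor of (i) forms a constant
invariant [cf. Remark 3.8.1 (ii)] — i.e., a mono-analytic core — of the above infinite chain": any two
`ⁿ𝒟_>^⊢`, `ᵐ𝒟_>^⊢` are identified by a (full, nonempty) poly-isomorphism, compatibly with the links (composition of
full poly-isomorphisms is full). [claim: Mochizuki2012, status: disputed] -/
theorem DThetaNFChain.core_spec (C : DThetaNFChain 𝔡) (n m : ℤ) :
    (DThetaNFLink 𝔡 (C.HT n) (C.HT m)).Nonempty ∧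
      ∀ e ∈ C.link n, ∀ e' ∈ DThetaNFLink 𝔡 (C.HT (n + 1)) (C.HT m),
        e ≪≫ e' ∈ DThetaNFLink 𝔡 (C.HT n) (C.HT m) :=
  ⟨dThetaNFLink_nonempty _ _, fun _ _ _ _ => Set.mem_univ _⟩

variable (𝔡) in
/-- **Corollary 4.12 (iii)** ([IUTchI] p. 121–122), the *étale-picture of `𝒟`-ΘNF-Hodge theaters* (Fig. 4.7): a
mono-analytic core `>^⊢` with spokes — `𝒟`-ΘNF-Hodge theaters (with their holomorphic processions) each attached
to the core by the full poly-isomorphism from the mono-analyticisation of its `†𝒟_>`.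
[claim: Mochizuki2012, status: disputed] -/
structure DEtalePicture where
  /-- the mono-analytic core `>^⊢` -/
  core : 𝔡.DMonoPrimeStrip
  /-- the spokes, labelled by `n ∈ ℤ` -/
  spoke : ℤ → 𝔡.DThetaNFHodgeTheater

/-- Cor. 4.12 (iii): the étale-picture of an infinite chain (core = any `ⁿ𝒟_>^⊢`, here `⁰𝒟_>^⊢`; spokes = the
Hodge theaters of the chain). [claim: Mochizuki2012, status: disputed] -/
def DThetaNFChain.etalePicture (C : DThetaNFChain 𝔡) : DEtalePicture 𝔡 where
  core := (C.HT 0).monoCod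
  spoke := C.HT

/-- Relabelling the spokes of an étale-picture by a permutation of `ℤ`. [claim: Mochizuki2012, status: disputed] -/
def DEtalePicture.perm (E : DEtalePicture 𝔡) (σ : Equiv.Perm ℤ) : DEtalePicture 𝔡 where
  core := E.core
  spoke := E.spoke ∘ σ

/-- The attaching datum of a spoke: the full poly-isomorphism from its `†𝒟_>^⊢` to the core (always nonempty).
[claim: Mochizuki2012, status: disputed] -/
def DEtalePicture.attach (E : DEtalePicture 𝔡) (n : ℤ) : PolyIso (E.spoke n).monoCod E.core := PolyIso.full _ _

/-- **Corollary 4.12 (iii)**: "this diagram satisfies the important property of admitting arbitrary permutation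
symmetries among the spokes [i.e., among the labels `n ∈ ℤ` of the `𝒟`-ΘNF-Hodge theaters]" — permuting the
spokes yields an étale-picture with the same core and the same (full, nonempty) attaching poly-isomorphisms,
spoke by spoke; contrast the Frobenius-picture (the chain), whose links distinguish `n` from `n + 1`.
[claim: Mochizuki2012, status: disputed] -/
theorem DEtalePicture.perm_spec (E : DEtalePicture 𝔡) (σ : Equiv.Perm ℤ) :
    (E.perm σ).core = E.core ∧ (∀ n, (E.perm σ).spoke n = E.spoke (σ n)) ∧
      (∀ n, (E.perm σ).attach n = E.attach (σ n) ∧ ((E.perm σ).attach n).Nonempty) ∧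
      (E.perm σ).perm σ.symm = E := by
  refine ⟨rfl, fun n => rfl, fun n => ⟨rfl, ?_⟩, ?_⟩
  · obtain ⟨e⟩ := DMonoPrimeStrip.nonempty_iso ((E.perm σ).spoke n).monoCod (E.perm σ).core
    exact ⟨e, Set.mem_univ _⟩
  · cases E
    simp only [DEtalePicture.perm, Function.comp_assoc, Equiv.self_comp_symm, Function.comp_id]

end BaseThetaDatum

end Literature.IUT.HodgeTheaters
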